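import Summits.QuantumFields.YangMills.Theorems.PoincareLipschitzOrbitMinimiserCoulomb
import Literature.MathematicalPhysics.QuantumFieldTheory.Balaban1983to89.T4AvgSensitivity
import HarnessLib

/-!
# Crux stmt-QuantumFields-19936 `UnitScaleTilt.HistoryTailL`, K2 at depth (route crux `PoincareLipschitz.BlockLipschitzL`, stmt-QuantumFields-23533):
# F2 — THE ORBIT MINIMISER AT EVERY LEVEL (level-generic twins of the level-zero letters of ✓p681042 ∕ ✓p681590, for the per-level
# re-minimisation of the supplier's induction F6)

The orbit-minimiser door ✓`PoincareLipschitzAvgStabilityOrbitMin.avgStabilityModGauge_of_orbitMinimising` (p681042) and the one-site optimality letters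
✓`PoincareLipschitzOrbitMinCoulomb.reTr_oneSite_le_of_orbitMin` (p681590) are pinned to level `0` (fields `GaugeField P 0`, gauge transformations
`GaugeTransf P 0`).  The supplier's induction (K2 supplier plan of record, card v1.27, row F6) re-minimises at every height `i` for the pair
`(Ū^i U, Ū^i U')` of level-`i` fields, with the later averages taken FROM level `i` (`T4AvgSensitivity.iterFrom`, `iter_add`:
`Ū^{i+n} = iterFrom i n ∘ Ū^i`).  This file supplies the level-generic letters, with the same proofs:

* §1 `exists_forall_le_of_continuous_level`, `continuous_boxDistSq_level`, ★`exists_orbitMinimiser_level` — a box-`ℓ²`-orbit minimiser over the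
  compact group `(Site P i → SU(2))` exists for every pair of level-`i` fields and every bond predicate;
* §2 ★`dist1_plaqHol_iterFrom_gaugeAct` — the averaged plaquette variables of the averages FROM level `i` are orbit functions of the level-`i` field
  (✓`T4AvgSensitivity.iterFrom_gaugeAct`, `plaqHol_gaugeAct`, `dist1_conj`), so level-`i` goodness windows survive re-gauging at level `i`;
* §3 ★`reTr_oneSite_le_of_orbitMin_level` — the one-site competitor at level `i`: at a level-`i` box-orbit minimiser the site functional
  `g ↦ Σ_{b∈box,b₋=x} reTr(g·V'_bV_b⁻¹) + Σ_{b∈box,b₊=x} reTr(g·V'_b⁻¹V_b)` is maximal on `SU(2)` at `g = 1` (whence, verbatim as at level `0`,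
  the Coulomb ∕ scalar ∕ Kirchhoff forms ✓p681590 §2–3 ∕ ✓p682271 ∕ ✓p682908, whose proofs read only this inequality and `M₂(ℂ)` algebra).

WHAT THIS IS NOT: nothing here proves h⋆ (✓p683030's hypothesis), `stub_iteratedLipschitz`, the crux `BlockLipschitzL`, the crux `HistoryTailL`,
rung R3 (YM₃ on T³ — not d = 4, not infinite volume, not a mass gap, not the Clay problem) or a summit statement.
Width seat ym-ust-19936-w5 g10 (cell ym3-torus), `--supports stmt-QuantumFields-19936`.
-/

noncomputable section

open scoped BigOperators Matrix.Norms.L2Operator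

namespace Summit.QuantumFields.YangMills.Theorems.PoincareLipschitzOrbitMinLevel

open Literature.MathematicalPhysics.QuantumFieldTheory.Balaban1983to89
open T4Continuum T4AvgSensitivity

/-! ## §1 Orbit minimisers at level `i` -/

section Minimiser

variable {P : Params} {i : ℕ}

/-- A continuous real function on the compact group of level-`i` gauge transformations `(Site P i → SU(2))` attains its minimum. [folklore] -/
theorem exists_forall_le_of_continuous_level (f : GaugeTransf P i (Matrix.specialUnitaryGroup (Fin 2) ℂ) → ℝ)
    (hf : Continuous (fun k : Site P i → Matrix.specialUnitaryGroup (Fin 2) ℂ => f k)) :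
    ∃ k₀ : GaugeTransf P i (Matrix.specialUnitaryGroup (Fin 2) ℂ), ∀ k, f k₀ ≤ f k := by
  haveI : CompactSpace (Site P i → Matrix.specialUnitaryGroup (Fin 2) ℂ) := inferInstance
  obtain ⟨k₀, -, hk₀⟩ := (isCompact_univ (X := Site P i → Matrix.specialUnitaryGroup (Fin 2) ℂ)).exists_isMinOn
    Set.univ_nonempty hf.continuousOn
  exact ⟨k₀, fun k => hk₀ (Set.mem_univ k)⟩

/-- The squared box distance `k ↦ Σ_b 𝟙_box(b)·dist1(V_b ((V'^k)_b)⁻¹)²` is continuous in the level-`i` gauge transformation `k`. [folklore] -/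
theorem continuous_boxDistSq_level (box : PBond P i → Prop) [DecidablePred box]
    (V V' : GaugeField P i (Matrix.specialUnitaryGroup (Fin 2) ℂ)) :
    Continuous (fun k : Site P i → Matrix.specialUnitaryGroup (Fin 2) ℂ =>
      ∑ b : PBond P i, if box b then dist1 (V b * (GaugeField.gaugeAct k V' b)⁻¹) ^ 2 else 0) := by
  refine continuous_finsetSum _ fun b _ => ?_
  by_cases hb : box b
  · simp only [hb, ↓reduceIte]
    have hk : Continuous (fun k : Site P i → Matrix.specialUnitaryGroup (Fin 2) ℂ => GaugeField.gaugeAct k V' b) := by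
      show Continuous (fun k : Site P i → Matrix.specialUnitaryGroup (Fin 2) ℂ => k b.src * V' b * (k b.tgt)⁻¹)
      exact ((continuous_apply b.src).mul continuous_const).mul (continuous_apply b.tgt).inv
    have hd : Continuous (dist1 : Matrix.specialUnitaryGroup (Fin 2) ℂ → ℝ) :=
      UnitaryModel.continuous_opDist1.comp (Literature.MathematicalPhysics.QuantumLattice.continuous_fundamentalRep (Fin 2))
    exact (hd.comp (continuous_const.mul hk.inv)).pow 2
  · simp only [hb, ↓reduceIte]
    exact continuous_const

/-- ★ **ORBIT MINIMISERS EXIST AT EVERY LEVEL**: for every pair `(V, V')` of level-`i` `SU(2)` fields and every bond predicate there is a level-`i` gauge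
transformation `k₀` minimising the squared box distance from `V` over the gauge orbit of `V'`. [folklore] -/
theorem exists_orbitMinimiser_level (box : PBond P i → Prop) [DecidablePred box]
    (V V' : GaugeField P i (Matrix.specialUnitaryGroup (Fin 2) ℂ)) :
    ∃ k₀ : GaugeTransf P i (Matrix.specialUnitaryGroup (Fin 2) ℂ), ∀ k : GaugeTransf P i (Matrix.specialUnitaryGroup (Fin 2) ℂ),
      (∑ b : PBond P i, if box b then dist1 (V b * (GaugeField.gaugeAct k₀ V' b)⁻¹) ^ 2 else 0) ≤
        ∑ b : PBond P i, if box b then dist1 (V b * (GaugeField.gaugeAct k V' b)⁻¹) ^ 2 else 0 :=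
  exists_forall_le_of_continuous_level _ (continuous_boxDistSq_level box V V')

end Minimiser

/-! ## §2 Goodness windows of the averages FROM level `i` are orbit functions of the level-`i` field -/

section Invariance

variable {P : Params} {G : Type*} [GaugeGroup G]

/-- ★ **`dist1 (avg^n(V^k)(∂q)) = dist1 (avg^n(V)(∂q))` FOR AVERAGES STARTED AT LEVEL `i`** (any averaging family, any gauge group; standing range
`i + n ≤ m + K`): ✓`iterFrom_gaugeAct`, `plaqHol_gaugeAct`, `dist1_conj`.  With ✓`iter_add` (`Ū^{i+n} U = iterFrom i n (Ū^i U)`) the crux windows at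
heights `≥ i` are invariant under re-gauging the level-`i` average. [cite: Balaban1985Averaging, (11)–(12) p.19] -/
theorem dist1_plaqHol_iterFrom_gaugeAct (av : ∀ j, Averaging P j G) {i n : ℕ} (hin : i + n ≤ P.m + P.K) (k : GaugeTransf P i G)
    (V : GaugeField P i G) (q : Plaq P (i + n)) :
    dist1 (GaugeField.plaqHol (iterFrom av i n (GaugeField.gaugeAct k V)) q) =
      dist1 (GaugeField.plaqHol (iterFrom av i n V) q) := by
  rw [iterFrom_gaugeAct av k n hin V, T4WilsonGaugeFlatDirection.plaqHol_gaugeAct, GaugeGroup.dist1_conj]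

/-- The bond variables of the averages from level `i` of a re-gauged field are the gauge copy by the lifted transformation (bondwise form of
✓`iterFrom_gaugeAct`, for footprint statements). [cite: Balaban1985Averaging, (11) p.19] -/
theorem iterFrom_gaugeAct_apply (av : ∀ j, Averaging P j G) {i n : ℕ} (hin : i + n ≤ P.m + P.K) (k : GaugeTransf P i G)
    (V : GaugeField P i G) (b : PBond P (i + n)) :
    iterFrom av i n (GaugeField.gaugeAct k V) b = transfUpFrom k n b.src * iterFrom av i n V b * (transfUpFrom k n b.tgt)⁻¹ := by
  rw [iterFrom_gaugeAct av k n hin V]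
  rfl

end Invariance

/-! ## §3 The one-site competitor at level `i` -/

section OneSite

variable {P : Params} {i : ℕ}

/-- ★ **THE ONE-SITE COMPETITOR OF A LEVEL-`i` BOX-ℓ²-ORBIT MINIMISER** (verbatim twin of ✓`reTr_oneSite_le_of_orbitMin` one level up): if `V'` is a
box-`ℓ²`-closest point of its level-`i` gauge orbit to `V`, then for every site `x` of `T^{(i)}` and every `g ∈ SU(2)`
`Σ_{b∈box, b₋=x} reTr(g·V'_bV_b⁻¹) + Σ_{b∈box, b₊=x} reTr(g·V'_b⁻¹V_b) ≤ Σ_{b∈box, b₋=x} reTr(V'_bV_b⁻¹) + Σ_{b∈box, b₊=x} reTr(V'_b⁻¹V_b)`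
(`dist1² = 2(1 − reTr)` on `SU(2)`; no level-`i` bond is a loop since `sitesPerDir i = 2L^{m+K−i} ≥ 2`). [cite: Balaban1987RG1, (0.14) p.254] -/
theorem reTr_oneSite_le_of_orbitMin_level (box : PBond P i → Prop) [DecidablePred box]
    (V V' : GaugeField P i (Matrix.specialUnitaryGroup (Fin 2) ℂ))
    (hmin : ∀ k : GaugeTransf P i (Matrix.specialUnitaryGroup (Fin 2) ℂ),
      (∑ b : PBond P i, if box b then dist1 (V b * (V' b)⁻¹) ^ 2 else 0) ≤
        ∑ b : PBond P i, if box b then dist1 (V b * (GaugeField.gaugeAct k V' b)⁻¹) ^ 2 else 0)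
    (x : Site P i) (g : Matrix.specialUnitaryGroup (Fin 2) ℂ) :
    (∑ b : PBond P i, if box b ∧ b.src = x then reTr (g * (V' b * (V b)⁻¹)) else 0) +
        (∑ b : PBond P i, if box b ∧ b.tgt = x then reTr (g * ((V' b)⁻¹ * V b)) else 0) ≤
      (∑ b : PBond P i, if box b ∧ b.src = x then reTr (V' b * (V b)⁻¹) else 0) +
        (∑ b : PBond P i, if box b ∧ b.tgt = x then reTr ((V' b)⁻¹ * V b) else 0) := by
  -- `SU(2)`: `|g − 1|² = 2(1 − Re tr g)`
  have hsq : ∀ h : Matrix.specialUnitaryGroup (Fin 2) ℂ, dist1 h ^ 2 = 2 * (1 - reTr h) := fun h =>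
    MatrixNorms.opDist1_sq_eq_of_mem_specialUnitaryGroup_two h.2
  -- no bond is a loop: `b₊ ≠ b₋`
  have hN : 1 < P.sitesPerDir i := by
    have h1 : 1 ≤ P.L ^ (P.m + P.K - i) := Nat.one_le_pow _ _ P.L_pos
    show 1 < 2 * P.L ^ (P.m + P.K - i)
    omega
  haveI : Fact (1 < P.sitesPerDir i) := ⟨hN⟩
  have hne : ∀ b : PBond P i, ¬ (b.src = x ∧ b.tgt = x) := by
    rintro b ⟨hs, ht⟩
    have h1 : b.src.shift b.dir b.dir = b.src b.dir := by
      have : b.src.shift b.dir = b.src := ht.trans hs.symm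
      rw [this]
    simp only [Site.shift, Function.update_self, add_eq_left] at h1
    exact one_ne_zero h1
  -- the one-site competitor
  set δ : GaugeTransf P i (Matrix.specialUnitaryGroup (Fin 2) ℂ) := fun y => if y = x then g else 1 with hδ
  have key := hmin δ
  have hterm : ∀ b : PBond P i,
      (if box b then dist1 (V b * (GaugeField.gaugeAct δ V' b)⁻¹) ^ 2 else 0) =
        (if box b then dist1 (V b * (V' b)⁻¹) ^ 2 else 0) +
          2 * ((if box b ∧ b.src = x then reTr (V' b * (V b)⁻¹) else 0) - (if box b ∧ b.src = x then reTr (g * (V' b * (V b)⁻¹)) else 0)) +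
          2 * ((if box b ∧ b.tgt = x then reTr ((V' b)⁻¹ * V b) else 0) - (if box b ∧ b.tgt = x then reTr (g * ((V' b)⁻¹ * V b)) else 0)) := by
    intro b
    by_cases hb : box b
    · by_cases hs : b.src = x
      · have ht : ¬ b.tgt = x := fun ht => hne b ⟨hs, ht⟩
        have hgauge : GaugeField.gaugeAct δ V' b = g * V' b := by
          simp [GaugeField.gaugeAct, hδ, hs, ht]
        simp only [if_pos hb, if_pos (And.intro hb hs), if_neg (fun h : box b ∧ b.tgt = x => ht h.2), hgauge, sub_self,
          mul_zero, add_zero]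
        rw [hsq, hsq]
        have e1 : reTr (V b * (V' b)⁻¹) = reTr (V' b * (V b)⁻¹) := by
          rw [← GaugeGroup.reTr_inv]; congr 1; group
        have e2 : reTr (V b * (g * V' b)⁻¹) = reTr (g * (V' b * (V b)⁻¹)) := by
          rw [← GaugeGroup.reTr_inv]; congr 1; group
        rw [e1, e2]; ring
      · by_cases ht : b.tgt = x
        · have hgauge : GaugeField.gaugeAct δ V' b = V' b * g⁻¹ := by
            simp [GaugeField.gaugeAct, hδ, hs, ht]
          simp only [if_pos hb, if_neg (fun h : box b ∧ b.src = x => hs h.2), if_pos (And.intro hb ht), hgauge, sub_self,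
            mul_zero, add_zero]
          rw [hsq, hsq]
          have e1 : reTr (V b * (V' b)⁻¹) = reTr ((V' b)⁻¹ * V b) := by
            rw [← GaugeGroup.reTr_conj ((V' b)⁻¹ * V b) (V b)]; congr 1; group
          have e2 : reTr (V b * (V' b * g⁻¹)⁻¹) = reTr (g * ((V' b)⁻¹ * V b)) := by
            rw [← GaugeGroup.reTr_conj (g * ((V' b)⁻¹ * V b)) (V b)]; congr 1; group
          rw [e1, e2]; ring
        · have hgauge : GaugeField.gaugeAct δ V' b = V' b := by
            simp [GaugeField.gaugeAct, hδ, hs, ht]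
          simp only [if_neg (fun h : box b ∧ b.src = x => hs h.2), if_neg (fun h : box b ∧ b.tgt = x => ht h.2), hgauge, sub_self,
            mul_zero, add_zero]
    · simp only [if_neg hb, if_neg (fun h : box b ∧ b.src = x => hb h.1), if_neg (fun h : box b ∧ b.tgt = x => hb h.1), sub_self,
        mul_zero, add_zero]
  rw [Finset.sum_congr rfl fun b _ => hterm b, Finset.sum_add_distrib, Finset.sum_add_distrib, ← Finset.mul_sum, ← Finset.mul_sum,
    Finset.sum_sub_distrib, Finset.sum_sub_distrib] at key
  linarith

end OneSite

end Summit.QuantumFields.YangMills.Theorems.PoincareLipschitzOrbitMinLevel
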